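import Summits.Ventures.Crystal3D.Theorems.StickyWulffConstantGenericWallFloorDoubleTopLocalSound
import Summits.Ventures.Crystal3D.Theorems.StickyWulffConstantGenericWallFloorCubicCoords
import HarnessLib

/-!
# Double tops, local part 4: from the lattice vocabulary to the certificate (crux `GenericWallFloor`,
# line `WallLedgerG`, residual `#DT₁₁`; local half of R39d «DoubleStarFree»)

HONEST FRAMING. Part of the venture `Summits/Ventures/Crystal3D` (cell `crystal3d-full`), helper
`--supports` the crux `GenericWallFloor` (stmt-Ventures-19480) of `route-Ventures-StickyWulffConstant`,
registered line `WallLedgerG`, open stub `stub_twoSlabAdhesion`.  Bridges `…DoubleTopLocalSound`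
(`DTCert.sound`, matrix form in the cubic frame) to the tree's objects: a linear isometry `R` of
`EuclideanSpace ℝ (Fin 3)` (the relative rotation `A₁⁻¹A₂` of a bicrystal, after the slot normalisation
`u₁ = u₂ = slotSite 0`), the thirteen balls `wPt i` of the WALK CLUSTER of `slotSite 0` (the predecessor
`−s₀` of the top `0` and its twelve slot neighbours; `√2·cubicCoords (wPt i) = clusterInt i`), and an
eleventh ball `y`.

* `cubicMat R` — the matrix of `R` in the cubic frame (`cubicCoords (R w) = cubicMat R · cubicCoords w`,
  orthogonal: `cubicMat_orth`);
* `wPt`, `sqrt_two_smul_cubicCoords_wPt`; `DTCert.y0E` (the free slot as a point), `DTCert.bR`;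
* **`DTCert.eq_of_isometry`** — for a valid certificate `C`: if the walk cluster and its image under `R`
  are `1`-separated up to coincidence (`wPt i = R (wPt j) ∨ dist ≥ 1`), `y` is a unit vector at distance
  `≥ 1` from the `24` non-centre balls (when `C.useY`), and
  `‖cubicMat R · Bᵀ − 1‖_F² + 2‖y − y0E‖² < 1/C.Ktot`, then `cubicMat R = B`: the relative rotation IS
  the reference co-axial rotation of the certificate.

WHAT THIS IS NOT: the co-axiality clause (`R·Λ₀ = Λ₀` resp. a twin — next file), the reduction of
arbitrary walk slots `u₁, u₂` to `slotSite 0`, the global interval half; rung F-C1 not moved.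
-/

noncomputable section

namespace Summit.Ventures.Crystal3D.Theorems

open Matrix NearIdentity
open scoped InnerProductSpace

/-! ### The cubic matrix of an isometry -/

/-- The matrix of a linear isometry in the (orthonormal) cubic frame. -/
def cubicMat (R : EuclideanSpace ℝ (Fin 3) ≃ₗᵢ[ℝ] EuclideanSpace ℝ (Fin 3)) : Matrix (Fin 3) (Fin 3) ℝ :=
  Matrix.of fun i j => cubicCoords (R (cubicFrame j)) i

/-- `cubicCoords (R w) = cubicMat R · cubicCoords w`. -/
theorem cubicCoords_eq_cubicMat_mulVec (R : EuclideanSpace ℝ (Fin 3) ≃ₗᵢ[ℝ] EuclideanSpace ℝ (Fin 3))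
    (w : EuclideanSpace ℝ (Fin 3)) : cubicCoords (R w) = cubicMat R *ᵥ cubicCoords w :=
  cubicCoords_map R w

/-- The cubic matrix is orthogonal: `Mᵀ M = 1`. -/
theorem cubicMat_orth (R : EuclideanSpace ℝ (Fin 3) ≃ₗᵢ[ℝ] EuclideanSpace ℝ (Fin 3)) :
    (cubicMat R)ᵀ * cubicMat R = 1 := by
  ext i j
  rw [Matrix.mul_apply, Matrix.one_apply]
  simp only [Matrix.transpose_apply, cubicMat, Matrix.of_apply]
  exact cubicMatrix_orthogonal R i j

/-- Hence also `M Mᵀ = 1`. -/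
theorem cubicMat_orth' (R : EuclideanSpace ℝ (Fin 3) ≃ₗᵢ[ℝ] EuclideanSpace ℝ (Fin 3)) :
    cubicMat R * (cubicMat R)ᵀ = 1 :=
  mul_eq_one_comm.1 (cubicMat_orth R)

/-! ### The walk cluster of `slotSite 0` -/

/-- The thirteen balls of the walk cluster of the slot `s₀ = slotSite 0`: the predecessor `−s₀` of the
top `0` along `s₀` and its twelve slot neighbours `−s₀ + slotSite k` (index `k+1`; index `1` is the top). -/
def wPt : Fin 13 → EuclideanSpace ℝ (Fin 3) :=
  Fin.cases (-slotSite 0) fun k => -slotSite 0 + slotSite k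

/-- `cubicCoords (−x) = −cubicCoords x`. -/
theorem cubicCoords_neg (x : EuclideanSpace ℝ (Fin 3)) : cubicCoords (-x) = -cubicCoords x := by
  have := cubicCoords_sub 0 x
  simp only [zero_sub] at this
  rw [this]
  have h0 : cubicCoords 0 = 0 := by
    have := cubicCoords_smul 0 (0 : EuclideanSpace ℝ (Fin 3))
    simp only [zero_smul] at this; exact this
  rw [h0, zero_sub]

/-- `√2 · cubicCoords (wPt i) = clusterInt i`. -/
theorem sqrt_two_smul_cubicCoords_wPt (i : Fin 13) : Real.sqrt 2 • cubicCoords (wPt i) = fR i := by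
  have hs0 : Real.sqrt 2 ≠ 0 := by positivity
  have key : ∀ k : Fin 12, Real.sqrt 2 • cubicCoords (slotSite k) = fun l => (slotInt k l : ℝ) := by
    intro k; rw [cubicCoords_slotSite]; ext l; simp [slotVec]; field_simp
  obtain ⟨h0, hs⟩ := clusterInt_facts
  refine Fin.cases ?_ (fun k => ?_) i
  · show Real.sqrt 2 • cubicCoords (-slotSite 0) = fR 0
    rw [cubicCoords_neg, smul_neg, key 0]
    ext l; simp only [fR, castVec, clusterQ, Pi.neg_apply, h0]; push_cast; ring
  · show Real.sqrt 2 • cubicCoords (-slotSite 0 + slotSite k) = fR k.succ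
    rw [cubicCoords_add, cubicCoords_neg, smul_add, smul_neg, key 0, key k]
    ext l; simp only [fR, castVec, clusterQ, Pi.add_apply, Pi.neg_apply, hs k, h0]; push_cast; ring

/-- Squared distances in the cluster scale: `(√2·c(x)) ⬝ (√2·c(x)) = 2‖x‖²`. -/
theorem sqrt_two_smul_cubicCoords_dot_self (x : EuclideanSpace ℝ (Fin 3)) :
    (Real.sqrt 2 • cubicCoords x) ⬝ᵥ (Real.sqrt 2 • cubicCoords x) = 2 * ‖x‖ ^ 2 := by
  have hs : Real.sqrt 2 ^ 2 = 2 := Real.sq_sqrt (by norm_num)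
  rw [norm_sq_eq_cubicCoords, smul_dotProduct, dotProduct_smul, smul_eq_mul, smul_eq_mul, ← mul_assoc,
    ← pow_two, hs]

namespace NearIdentity.DTCert

variable (C : DTCert)

/-- The reference rotation as a real matrix. -/
def bR : Matrix (Fin 3) (Fin 3) ℝ := Matrix.of fun i j => ((C.B i j : ℚ) : ℝ)

/-- The free slot as a point of space: `√2 · cubicCoords y0E = y₀`. -/
def y0E : EuclideanSpace ℝ (Fin 3) := (Real.sqrt 2)⁻¹ • ∑ l : Fin 3, ((C.y0 l : ℚ) : ℝ) • cubicFrame l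

/-- `√2 · cubicCoords y0E = y0R`. -/
theorem sqrt_two_smul_cubicCoords_y0E : Real.sqrt 2 • cubicCoords C.y0E = C.y0R := by
  have hs0 : Real.sqrt 2 ≠ 0 := by positivity
  have hsum : cubicCoords (∑ l : Fin 3, ((C.y0 l : ℚ) : ℝ) • cubicFrame l) = C.y0R := by
    simp only [Fin.sum_univ_three, cubicCoords_add, cubicCoords_smul, cubicCoords_cubicFrame]
    ext l; fin_cases l <;> simp [y0R, castVec]
  rw [y0E, cubicCoords_smul, hsum, smul_smul, mul_inv_cancel₀ hs0, one_smul]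

/-- Orthogonality of `B` in real form. -/
theorem bR_orth (hB : C.validB) : C.bRᵀ * C.bR = 1 ∧ C.bR * C.bRᵀ = 1 := by
  obtain ⟨h1, h2, -⟩ := hB
  constructor
  · ext i j
    have := h1 i j
    have h' : ((C.B 0 i * C.B 0 j + C.B 1 i * C.B 1 j + C.B 2 i * C.B 2 j : ℚ) : ℝ) =
        ((if i = j then 1 else 0 : ℚ) : ℝ) := by rw [this]
    rw [Matrix.mul_apply, Matrix.one_apply]
    simp only [Fin.sum_univ_three, Matrix.transpose_apply, bR, Matrix.of_apply]
    push_cast at h'; rw [h']; split_ifs <;> simp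
  · ext i j
    have := h2 i j
    have h' : ((C.B i 0 * C.B j 0 + C.B i 1 * C.B j 1 + C.B i 2 * C.B j 2 : ℚ) : ℝ) =
        ((if i = j then 1 else 0 : ℚ) : ℝ) := by rw [this]
    rw [Matrix.mul_apply, Matrix.one_apply]
    simp only [Fin.sum_univ_three, Matrix.transpose_apply, bR, Matrix.of_apply]
    push_cast at h'; rw [h']; split_ifs <;> simp

/-- `Q j = B · F̂ j` in real form. -/
theorem qR_eq_bR_mulVec (hB : C.validB) (j : Fin 13) : C.qR j = C.bR *ᵥ fR j := by
  obtain ⟨-, -, h3⟩ := hB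
  ext i
  have := congrFun (h3 j) i
  simp only [qR, castVec, this, mulQ, Matrix.mulVec, dotProduct, Fin.sum_univ_three, bR, Matrix.of_apply,
    fR, clusterQ]
  push_cast; ring

/-- **From the lattice vocabulary to the certificate.**  See the module docstring. -/
theorem eq_of_isometry (hC : C.valid) (R : EuclideanSpace ℝ (Fin 3) ≃ₗᵢ[ℝ] EuclideanSpace ℝ (Fin 3))
    (y : EuclideanSpace ℝ (Fin 3))
    (hclus : ∀ i j : Fin 13, wPt i = R (wPt j) ∨ 1 ≤ dist (wPt i) (R (wPt j)))
    (hy : C.useY = true → ‖y‖ = 1)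
    (hyF : C.useY = true → ∀ i, clusterQ i ≠ 0 → 1 ≤ dist y (wPt i))
    (hyM : C.useY = true → ∀ j, clusterQ j ≠ 0 → 1 ≤ dist y (R (wPt j)))
    (hsmall : frob (cubicMat R * C.bRᵀ - 1) + (if C.useY then 2 * ‖y - C.y0E‖ ^ 2 else 0) < 1 / C.Ktot) :
    cubicMat R = C.bR := by
  have hB : C.validB := hC.2.2.2.2.2.2.2
  obtain ⟨hBtB, hBBt⟩ := C.bR_orth hB
  set M := cubicMat R with hM
  set κ : Matrix (Fin 3) (Fin 3) ℝ := M * C.bRᵀ - 1 with hκ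
  have h1κ : 1 + κ = M * C.bRᵀ := by rw [hκ]; abel
  -- orthogonality of `1 + κ`
  have hMtM : Mᵀ * M = 1 := cubicMat_orth R
  have hprod : (1 + κ)ᵀ * (1 + κ) = 1 := by
    rw [h1κ, Matrix.transpose_mul, Matrix.transpose_transpose, Matrix.mul_assoc, ← Matrix.mul_assoc Mᵀ,
      hMtM, Matrix.one_mul, hBBt]
  have horth : ∀ i j, κ i j + κ j i + ∑ l, κ l i * κ l j = 0 := by
    intro i j
    have h := congrFun (congrFun hprod i) j
    rw [Matrix.mul_apply, Matrix.one_apply] at h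
    simp only [Matrix.transpose_apply, Matrix.add_apply, Matrix.one_apply] at h
    simp only [Fin.sum_univ_three] at h ⊢
    fin_cases i <;> fin_cases j <;> simp at h ⊢ <;> linarith
  -- the moving balls: `(1+κ) Q j = M F̂ j = √2 · cubicCoords (R (wPt j))`
  have hmov : ∀ j, C.qR j + κ *ᵥ C.qR j = Real.sqrt 2 • cubicCoords (R (wPt j)) := by
    intro j
    have e1 : C.qR j + κ *ᵥ C.qR j = (1 + κ) *ᵥ C.qR j := by rw [Matrix.add_mulVec, Matrix.one_mulVec]
    rw [e1, h1κ, C.qR_eq_bR_mulVec hB j, Matrix.mulVec_mulVec, Matrix.mul_assoc, hBtB, Matrix.mul_one,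
      cubicCoords_eq_cubicMat_mulVec, ← sqrt_two_smul_cubicCoords_wPt, Matrix.mulVec_smul]
  -- scaled eleventh ball
  set yh : Fin 3 → ℝ := Real.sqrt 2 • cubicCoords y with hyh
  -- the hypotheses of `sound`
  have Hclus : ∀ i j, fR i = C.qR j + κ *ᵥ C.qR j ∨
      2 ≤ (fR i - (C.qR j + κ *ᵥ C.qR j)) ⬝ᵥ (fR i - (C.qR j + κ *ᵥ C.qR j)) := by
    intro i j
    rw [hmov j, ← sqrt_two_smul_cubicCoords_wPt i]
    rcases hclus i j with h | h
    · left; rw [h]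
    · right
      rw [← smul_sub, ← cubicCoords_sub, sqrt_two_smul_cubicCoords_dot_self, ← dist_eq_norm]
      nlinarith [h]
  have Hy : C.useY = true → yh ⬝ᵥ yh = 2 := by
    intro huse; rw [hyh, sqrt_two_smul_cubicCoords_dot_self, hy huse]; norm_num
  have HcF : C.useY = true → ∀ i, clusterQ i ≠ 0 → 2 ≤ (yh - fR i) ⬝ᵥ (yh - fR i) := by
    intro huse i hi
    rw [hyh, ← sqrt_two_smul_cubicCoords_wPt i, ← smul_sub, ← cubicCoords_sub, sqrt_two_smul_cubicCoords_dot_self,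
      ← dist_eq_norm]
    nlinarith [hyF huse i hi]
  have HcM : C.useY = true → ∀ j, C.Q j ≠ 0 →
      2 ≤ (yh - (C.qR j + κ *ᵥ C.qR j)) ⬝ᵥ (yh - (C.qR j + κ *ᵥ C.qR j)) := by
    intro huse j hj
    have hj' : clusterQ j ≠ 0 := by
      intro h0
      apply hj
      obtain ⟨-, -, h3⟩ := hB
      rw [h3 j, h0]; ext i; simp [mulQ]
    rw [hyh, hmov j, ← smul_sub, ← cubicCoords_sub, sqrt_two_smul_cubicCoords_dot_self, ← dist_eq_norm]
    nlinarith [hyM huse j hj']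
  have Hsmall : frob κ + (if C.useY then (yh - C.y0R) ⬝ᵥ (yh - C.y0R) else 0) < 1 / C.Ktot := by
    have e : (yh - C.y0R) ⬝ᵥ (yh - C.y0R) = 2 * ‖y - C.y0E‖ ^ 2 := by
      rw [hyh, ← C.sqrt_two_smul_cubicCoords_y0E, ← smul_sub, ← cubicCoords_sub,
        sqrt_two_smul_cubicCoords_dot_self]
    rw [e]; exact hsmall
  have hκ0 : κ = 0 := C.sound hC κ horth yh Hclus Hy HcF HcM Hsmall
  -- `M Bᵀ = 1`, hence `M = B`
  have h1 : M * C.bRᵀ = 1 := by rw [← h1κ, hκ0, add_zero]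
  calc M = M * (C.bRᵀ * C.bR) := by rw [hBtB, Matrix.mul_one]
    _ = (M * C.bRᵀ) * C.bR := by rw [Matrix.mul_assoc]
    _ = C.bR := by rw [h1, Matrix.one_mul]

end NearIdentity.DTCert

end Summit.Ventures.Crystal3D.Theorems

end
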